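import Mathlib
import HarnessLib
import Summits.HubbardSuperconductivity.HubbardSuperconductivity.Theorems.KLProgrammeC4aTangencyCalculusTwo
import Summits.HubbardSuperconductivity.HubbardSuperconductivity.Theorems.KLProgrammeC4aPartnerBandTangencyDefectPh

/-!
# Route `KLProgramme` — crux C4a, S3 brick (B2, TANGENCY, ORDER 2, ph twin): the SECOND co-moving jet of the ph partner band near the `2k_F` configuration `(ρ,ϑ) = (0,π)` is
# `O(φ² + |e| + |ρ| + |ϑ − π|)`, uniformly in the base angle

Cell `gate-hubbard-kl`, lane hubbard-kl-c4a-1 (g6); helper for stub (C) `stub_twoLeg_curvature` of the engine-flow child `KLRegimeEngineV17F2`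
(stmt-HubbardSuperconductivity-20437); memo HOME/hubbard-kl-c4a-1/C4A-PLAN.md §24.4 (ii), §24.8.  Twin of `…C4aPartnerBandTangencyDefectTwo` for the ph loop: with
`T(x,η,y) := ∂_t²|₀ e_K(Φ(y, φ+θ+t) − D_{x,η,θ}(t))`, the reductions `T(ρ,ϑ,e) → T(ρ,ϑ,0) → T(0,π,0)` go through `abs_jet_two_sub_le` (radial rows for `e`;
`D_{0,π} − D_{ρ,ϑ} = pairSumPath` and g5's Cooper rigidity `norm_pairSumPath_zero_le`, `norm_deriv_pairSumPath_le_rigid`, `norm_iteratedDeriv_pairSumPath_le_rigid` for the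
configuration), and `T(0,π,0)` is the order-2 tangency core by evenness of `e_K` (`frameLevel_neg`, `pairDiffPath_tangency`).

* `iteratedDeriv_two_partnerBand_ph_eq`, `iteratedDeriv_pairSumPath_zero_eq_neg_sub`;
* **`abs_iteratedDeriv_two_partnerBand_ph_tangency_le`** — `|T(ρ,ϑ,e)| ≤ C₂(φ)·φ² + B₁(|e|) + B₂(|ρ|,|ϑ − π|)`.

Pure calculus on landed objects; nothing about the model's sizes; nothing asserts superconductivity.  References: FST II CPAM 51 (1998) §3; BGM 2006 §2.4 (2.40) [cite: BenfattoGiulianiMastropietro2006].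
-/

noncomputable section

namespace Summit.HubbardSuperconductivity.HubbardSuperconductivity.Theorems.C4a

set_option linter.dupNamespace false -- summit = problem name (single-conjunct summit), D-0017

open Real Set Filter
open scoped Topology
open Literature.MathematicalPhysics.QuantumLattice Literature.MathematicalPhysics.QuantumLattice.BandSectorCounting Literature.Probability.LatticeModels
open Summit.HubbardSuperconductivity.HubbardSuperconductivity.Theorems.KLRegimeSplit
open Summit.HubbardSuperconductivity.HubbardSuperconductivity.Theorems.DispersionFlow
open Summit.HubbardSuperconductivity.HubbardSuperconductivity.Theorems.PerturbedFermiCurve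

section Sizes

variable {K : TrigPolyC4v} {A : ℝ} (hA : ∀ p : Momentum, ∀ j ≤ 2, ‖iteratedFDeriv ℝ j (frameShift K) p‖ ≤ A) (hA20 : A ≤ 1 / 20)
  (hd : klCurveD ≤ (bandBounds (show (-4 : ℝ) < -1.1 by norm_num) (show (-1.1 : ℝ) ≤ -0.1 by norm_num)
    (show (-0.1 : ℝ) < 0 by norm_num)).Dtmin - 2 * A)
  {μ r : ℝ} (hr : 0 < r) (hlo : (-1.1 : ℝ) < μ - r - A) (hhi : μ + r + A < -0.1)
  {A₃ A₄ : ℝ} (hA₃ : ∀ p : Momentum, ‖iteratedFDeriv ℝ 3 (frameShift K) p‖ ≤ A₃)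
  (hA₄ : ∀ p : Momentum, ‖iteratedFDeriv ℝ 4 (frameShift K) p‖ ≤ A₄)
  {K₁ K₂ K₃ K₄ : ℝ} (hK₁ : ∀ p : Momentum, ‖fderiv ℝ (frameLevel μ K) p‖ ≤ K₁) (hK₂ : ∀ p : Momentum, ‖iteratedFDeriv ℝ 2 (frameLevel μ K) p‖ ≤ K₂)
  (hK₃ : ∀ p : Momentum, ‖iteratedFDeriv ℝ 3 (frameLevel μ K) p‖ ≤ K₃) (hK₄ : ∀ p : Momentum, ‖iteratedFDeriv ℝ 4 (frameLevel μ K) p‖ ≤ K₄)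
include hA hA20 hd hr hlo hhi hA₃ hA₄ hK₁ hK₂ hK₃ hK₄

omit hA20 hA₃ hA₄ hK₁ hK₂ hK₃ hK₄ in
/-- **The order-2 chain expression of the ph partner band**: `∂_t²|₀ e_K(Φ(y,φ+θ+t) − D_{x,η,θ}(t)) = D²e_K(p)[u₁,u₁] + De_K(p)[u₂]` with
`p = Φ(y,φ+θ) − D(0)`, `u_j = ∂ʲΦ(y,·)(φ+θ) − (∂ʲΦ(0,·)(θ) − ∂ʲΦ(x,·)(η+θ))`. -/
theorem iteratedDeriv_two_partnerBand_ph_eq {x y : ℝ} (hx : |x| < r) (hy : |y| < r) (η θ φ : ℝ) :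
    iteratedDeriv 2 (fun t : ℝ => frameLevel μ K (levelPoint μ K y (φ + θ + t) - pairDiffPath μ K x η θ t)) 0 =
      fderiv ℝ (fderiv ℝ (frameLevel μ K)) (levelPoint μ K y (φ + θ) - pairDiffPath μ K x η θ 0) (iteratedDeriv 1 (levelPoint μ K y) (φ + θ) - (iteratedDeriv 1 (levelPoint μ K 0) θ - iteratedDeriv 1 (levelPoint μ K x) (η + θ)))
        (iteratedDeriv 1 (levelPoint μ K y) (φ + θ) - (iteratedDeriv 1 (levelPoint μ K 0) θ - iteratedDeriv 1 (levelPoint μ K x) (η + θ))) +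
      fderiv ℝ (frameLevel μ K) (levelPoint μ K y (φ + θ) - pairDiffPath μ K x η θ 0) (iteratedDeriv 2 (levelPoint μ K y) (φ + θ) - (iteratedDeriv 2 (levelPoint μ K 0) θ - iteratedDeriv 2 (levelPoint μ K x) (η + θ))) := by
  set B₀ := bandBounds (show (-4 : ℝ) < -1.1 by norm_num) (show (-1.1 : ℝ) ≤ -0.1 by norm_num) (show (-0.1 : ℝ) < 0 by norm_num) with hB₀
  have hADt : 2 * A < B₀.Dtmin := by have := klCurveD_pos; linarith
  have hf : ContDiff ℝ 4 (frameLevel μ K) := EngineV8.contDiff_frameLevel μ K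
  have hD : ContDiff ℝ 4 (pairDiffPath μ K x η θ) := contDiff_pairDiffPath B₀ hA hADt hr hlo hhi hx η θ
  have hγ : ContDiff ℝ 4 (fun t : ℝ => levelPoint μ K y (φ + θ + t)) := (contDiff_levelPoint_angle B₀ hA hADt hlo hhi hy).comp (contDiff_const.add contDiff_id)
  have hc : ContDiff ℝ 4 (fun t : ℝ => levelPoint μ K y (φ + θ + t) - pairDiffPath μ K x η θ t) := hγ.sub hD
  have hjet : ∀ {j : ℕ}, j ≤ 2 → iteratedDeriv j (fun t : ℝ => levelPoint μ K y (φ + θ + t) - pairDiffPath μ K x η θ t) 0 =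
      iteratedDeriv j (levelPoint μ K y) (φ + θ) - (iteratedDeriv j (levelPoint μ K 0) θ - iteratedDeriv j (levelPoint μ K x) (η + θ)) := fun {j} hj => by
    have hj4 : (j : WithTop ℕ∞) ≤ 4 := by exact_mod_cast (hj.trans (by norm_num : 2 ≤ 4))
    rw [iteratedDeriv_fun_sub (hγ.contDiffAt.of_le hj4) (hD.contDiffAt.of_le hj4), iteratedDeriv_pairDiffPath_zero hA hd hr hlo hhi hx η θ j,
      iteratedDeriv_comp_const_add]
    simp only [add_zero]
  have hfun : (fun t : ℝ => frameLevel μ K (levelPoint μ K y (φ + θ + t) - pairDiffPath μ K x η θ t)) =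
      frameLevel μ K ∘ fun t : ℝ => levelPoint μ K y (φ + θ + t) - pairDiffPath μ K x η θ t := rfl
  rw [hfun, iteratedDeriv_two_comp_eq hf hc 0, hjet (j := 1) (by norm_num), hjet (j := 2) le_rfl]
  simp only [add_zero]

omit hA20 hA₃ hA₄ hK₁ hK₂ hK₃ hK₄ in
/-- The jets of the pair-sum path as the DIFFERENCE of the ph jets at `(ρ,ϑ)` and at `(0,π)`: `∂ʲS_{ρ,ϑ}(0) = ∂ʲΦ(ρ,·)(ϑ+θ) − ∂ʲΦ(0,·)(π+θ)`. -/
theorem iteratedDeriv_pairSumPath_zero_eq_neg_sub {ρ : ℝ} (hρ : |ρ| < r) (ϑ θ : ℝ) (j : ℕ) :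
    iteratedDeriv j (pairSumPath μ K ρ ϑ θ) 0 = iteratedDeriv j (levelPoint μ K ρ) (ϑ + θ) - iteratedDeriv j (levelPoint μ K 0) (π + θ) := by
  rw [iteratedDeriv_pairSumPath_zero hA hd hr hlo hhi hρ ϑ θ j, show π + θ = θ + π by ring, iteratedDeriv_levelPoint_add_pi]
  abel

/-- **THE SECOND CO-MOVING JET OF THE ph PARTNER BAND NEAR `2k_F`**: for every loop level `|e| < r`, loop angle `φ`, configuration `|ρ| < r`, `ϑ`:
`|∂_t²|₀ e_K(Φ(e, φ+θ+t) − D(t))| ≤ C₂(φ)·φ² + B₁·|e| + B₂(|ρ|, |ϑ − π|)`. -/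
theorem abs_iteratedDeriv_two_partnerBand_ph_tangency_le {ρ : ℝ} (hρ : |ρ| < r) {e : ℝ} (he : |e| < r) (ϑ θ φ : ℝ) :
    |iteratedDeriv 2 (fun t : ℝ => frameLevel μ K (levelPoint μ K e (φ + θ + t) - pairDiffPath μ K ρ ϑ θ t)) 0| ≤
      (K₄ * msD A₃ A₄ 1 ^ 2 * (msD A₃ A₄ 1 + |φ| * msD A₃ A₄ 2) ^ 2 + 4 * K₃ * msD A₃ A₄ 1 * msD A₃ A₄ 2 * (msD A₃ A₄ 1 + |φ| * msD A₃ A₄ 2) + 2 * K₂ * msD A₃ A₄ 2 ^ 2 + K₃ * msD A₃ A₄ 1 ^ 2 * (msD A₃ A₄ 2 + |φ| * msD A₃ A₄ 3) + 2 * K₂ * msD A₃ A₄ 1 * msD A₃ A₄ 3 +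
          K₃ * msD A₃ A₄ 2 * (msD A₃ A₄ 1 + |φ| * msD A₃ A₄ 2 + msD A₃ A₄ 3 * φ ^ 2) ^ 2 + K₂ * msD A₃ A₄ 3 * (2 * (msD A₃ A₄ 1 + |φ| * msD A₃ A₄ 2) + msD A₃ A₄ 3 * φ ^ 2) + K₂ * msD A₃ A₄ 2 * (msD A₃ A₄ 2 + |φ| * msD A₃ A₄ 3 + msD A₃ A₄ 4 * φ ^ 2) + K₁ * msD A₃ A₄ 4) *
          φ ^ 2 +
        (K₃ * (|e| / ((bandBounds (show (-4 : ℝ) < -1.1 by norm_num) (show (-1.1 : ℝ) ≤ -0.1 by norm_num) (show (-0.1 : ℝ) < 0 by norm_num)).Dtmin - 2 * A)) * (3 * msD A₃ A₄ 1) ^ 2 + K₂ * (radialRowOneConst A ((bandBounds (show (-4 : ℝ) < -1.1 by norm_num) (show (-1.1 : ℝ) ≤ -0.1 by norm_num) (show (-0.1 : ℝ) < 0 by norm_num)).Dtmin - 2 * A) * |e|) * (3 * msD A₃ A₄ 1 + 3 * msD A₃ A₄ 1) + K₂ * (|e| / ((bandBounds (show (-4 : ℝ) < -1.1 by norm_num)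 (show (-1.1 : ℝ) ≤ -0.1 by norm_num) (show (-0.1 : ℝ) < 0 by norm_num)).Dtmin - 2 * A)) * (3 * msD A₃ A₄ 2) +
          K₁ * ((uRowTwoConst A A₃ ((bandBounds (show (-4 : ℝ) < -1.1 by norm_num) (show (-1.1 : ℝ) ≤ -0.1 by norm_num) (show (-0.1 : ℝ) < 0 by norm_num)).Dtmin - 2 * A) + 1 / ((bandBounds (show (-4 : ℝ) < -1.1 by norm_num) (show (-1.1 : ℝ) ≤ -0.1 by norm_num) (show (-0.1 : ℝ) < 0 by norm_num)).Dtmin - 2 * A) + 2 * (radialRowOneConst A ((bandBounds (show (-4 : ℝ) < -1.1 by norm_num) (show (-1.1 : ℝ) ≤ -0.1 by norm_num) (show (-0.1 : ℝ) < 0 by norm_num)).Dtmin - 2 * A) - 1 / ((bandBounds (show (-4 : ℝ) < -1.1 by norm_num) (show (-1.1 : ℝ) ≤ -0.1 by norm_num) (show (-0.1 : ℝ) < 0 by norm_num)).Dtmin - 2 * A))) * |e|)) +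
        (K₃ * (|ρ| / ((bandBounds (show (-4 : ℝ) < -1.1 by norm_num) (show (-1.1 : ℝ) ≤ -0.1 by norm_num) (show (-0.1 : ℝ) < 0 by norm_num)).Dtmin - 2 * A) + msD A₃ A₄ 1 * |ϑ - π|) * (3 * msD A₃ A₄ 1) ^ 2 + K₂ * (radialRowOneConst A ((bandBounds (show (-4 : ℝ) < -1.1 by norm_num) (show (-1.1 : ℝ) ≤ -0.1 by norm_num) (show (-0.1 : ℝ) < 0 by norm_num)).Dtmin - 2 * A) * |ρ| + msD A₃ A₄ 2 * |ϑ - π|) * (3 * msD A₃ A₄ 1 + 3 * msD A₃ A₄ 1) +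
          K₂ * (|ρ| / ((bandBounds (show (-4 : ℝ) < -1.1 by norm_num) (show (-1.1 : ℝ) ≤ -0.1 by norm_num) (show (-0.1 : ℝ) < 0 by norm_num)).Dtmin - 2 * A) + msD A₃ A₄ 1 * |ϑ - π|) * (3 * msD A₃ A₄ 2) + K₁ * ((uRowTwoConst A A₃ ((bandBounds (show (-4 : ℝ) < -1.1 by norm_num) (show (-1.1 : ℝ) ≤ -0.1 by norm_num) (show (-0.1 : ℝ) < 0 by norm_num)).Dtmin - 2 * A) + 1 / ((bandBounds (show (-4 : ℝ) < -1.1 by norm_num) (show (-1.1 : ℝ) ≤ -0.1 by norm_num) (show (-0.1 : ℝ) < 0 by norm_num)).Dtmin - 2 * A) + 2 * (radialRowOneConst A ((bandBounds (show (-4 : ℝ) < -1.1 by norm_num) (show (-1.1 : ℝ) ≤ -0.1 by norm_num) (show (-0.1 : ℝ) < 0 by norm_num)).Dtmin - 2 * A) - 1 / ((bandBounds (show (-4 : ℝ) < -1.1 by norm_num) (show (-1.1 : ℝ) ≤ -0.1 by norm_num) (show (-0.1 : ℝ) < 0 by norm_num)).Dtmin - 2 * A))) * |ρ| + msD A₃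 A₄ 3 * |ϑ - π|)) := by
  set B₀ := bandBounds (show (-4 : ℝ) < -1.1 by norm_num) (show (-1.1 : ℝ) ≤ -0.1 by norm_num) (show (-0.1 : ℝ) < 0 by norm_num) with hB₀
  set dd := B₀.Dtmin - 2 * A with hdd
  have hADt : 2 * A < B₀.Dtmin := by have := klCurveD_pos; linarith
  have hdpos : 0 < dd := by rw [hdd]; linarith
  have h0 : |(0 : ℝ)| < r := by simpa using hr
  have hK₁0 : 0 ≤ K₁ := (norm_nonneg _).trans (hK₁ 0)
  have hK₂0 : 0 ≤ K₂ := (norm_nonneg _).trans (hK₂ 0)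
  have hK₃0 : 0 ≤ K₃ := (norm_nonneg _).trans (hK₃ 0)
  have hf : ContDiff ℝ 4 (frameLevel μ K) := EngineV8.contDiff_frameLevel μ K
  have hD : ∀ {x : ℝ}, |x| < r → ∀ {j : ℕ}, 1 ≤ j → j ≤ 4 → ∀ s, ‖iteratedDeriv j (levelPoint μ K x) s‖ ≤ msD A₃ A₄ j := fun hx _ hj1 hj4 s =>
    norm_iteratedDeriv_levelPoint_le hA hA20 hd hlo hhi hA₃ hA₄ hx hj1 hj4 s
  have hD₁0 : 0 ≤ msD A₃ A₄ 1 := (norm_nonneg _).trans (hD h0 le_rfl (by norm_num) 0)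
  have hD₂0 : 0 ≤ msD A₃ A₄ 2 := (norm_nonneg _).trans (hD h0 (j := 2) (by norm_num) (by norm_num) 0)
  -- sizes of the jets `u₁`, `u₂` for any admissible configuration
  have hU₁ : ∀ {x y : ℝ} (hx : |x| < r) (hy : |y| < r) (η : ℝ), ‖iteratedDeriv 1 (levelPoint μ K y) (φ + θ) - (iteratedDeriv 1 (levelPoint μ K 0) θ - iteratedDeriv 1 (levelPoint μ K x) (η + θ))‖ ≤ 3 * msD A₃ A₄ 1 := fun {x y} hx hy η => by
    have := norm_sub_le (iteratedDeriv 1 (levelPoint μ K y) (φ + θ)) (iteratedDeriv 1 (levelPoint μ K 0) θ - iteratedDeriv 1 (levelPoint μ K x) (η + θ))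
    have := norm_sub_le (iteratedDeriv 1 (levelPoint μ K 0) θ) (iteratedDeriv 1 (levelPoint μ K x) (η + θ))
    have := hD h0 le_rfl (by norm_num) θ; have := hD hx le_rfl (by norm_num) (η + θ); have := hD hy le_rfl (by norm_num) (φ + θ)
    linarith
  have hU₂ : ∀ {x y : ℝ} (hx : |x| < r) (hy : |y| < r) (η : ℝ), ‖iteratedDeriv 2 (levelPoint μ K y) (φ + θ) - (iteratedDeriv 2 (levelPoint μ K 0) θ - iteratedDeriv 2 (levelPoint μ K x) (η + θ))‖ ≤ 3 * msD A₃ A₄ 2 := fun {x y} hx hy η => by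
    have := norm_sub_le (iteratedDeriv 2 (levelPoint μ K y) (φ + θ)) (iteratedDeriv 2 (levelPoint μ K 0) θ - iteratedDeriv 2 (levelPoint μ K x) (η + θ))
    have := norm_sub_le (iteratedDeriv 2 (levelPoint μ K 0) θ) (iteratedDeriv 2 (levelPoint μ K x) (η + θ))
    have := hD h0 (j := 2) (by norm_num) (by norm_num) θ; have := hD hx (j := 2) (by norm_num) (by norm_num) (η + θ)
    have := hD hy (j := 2) (by norm_num) (by norm_num) (φ + θ)
    linarith
  -- STEP 1: the loop level `e → 0`
  have step1 : |iteratedDeriv 2 (fun t : ℝ => frameLevel μ K (levelPoint μ K e (φ + θ + t) - pairDiffPath μ K ρ ϑ θ t)) 0 -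
      iteratedDeriv 2 (fun t : ℝ => frameLevel μ K (levelPoint μ K 0 (φ + θ + t) - pairDiffPath μ K ρ ϑ θ t)) 0| ≤
      (K₃ * (|e| / ((bandBounds (show (-4 : ℝ) < -1.1 by norm_num) (show (-1.1 : ℝ) ≤ -0.1 by norm_num) (show (-0.1 : ℝ) < 0 by norm_num)).Dtmin - 2 * A)) * (3 * msD A₃ A₄ 1) ^ 2 + K₂ * (radialRowOneConst A ((bandBounds (show (-4 : ℝ) < -1.1 by norm_num) (show (-1.1 : ℝ) ≤ -0.1 by norm_num) (show (-0.1 : ℝ) < 0 by norm_num)).Dtmin - 2 * A) * |e|) * (3 * msD A₃ A₄ 1 + 3 * msD A₃ A₄ 1) + K₂ * (|e| / ((bandBounds (show (-4 : ℝ) < -1.1 by norm_num) (show (-1.1 : ℝ) ≤ -0.1 by norm_num) (show (-0.1 : ℝ) < 0 by norm_num)).Dtmin - 2 * A)) * (3 * msD A₃ A₄ 2) +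
          K₁ * ((uRowTwoConst A A₃ ((bandBounds (show (-4 : ℝ) < -1.1 by norm_num) (show (-1.1 : ℝ) ≤ -0.1 by norm_num) (show (-0.1 : ℝ) < 0 by norm_num)).Dtmin - 2 * A) + 1 / ((bandBounds (show (-4 : ℝ) < -1.1 by norm_num) (show (-1.1 : ℝ) ≤ -0.1 by norm_num) (show (-0.1 : ℝ) < 0 by norm_num)).Dtmin - 2 * A) + 2 * (radialRowOneConst A ((bandBounds (show (-4 : ℝ) < -1.1 by norm_num) (show (-1.1 : ℝ) ≤ -0.1 by norm_num) (show (-0.1 : ℝ) < 0 by norm_num)).Dtmin - 2 * A) - 1 / ((bandBounds (show (-4 : ℝ) < -1.1 by norm_num) (show (-1.1 : ℝ) ≤ -0.1 by norm_num) (show (-0.1 : ℝ) < 0 by norm_num)).Dtmin - 2 * A))) * |e|)) := by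
    rw [iteratedDeriv_two_partnerBand_ph_eq hA hd hr hlo hhi hρ he ϑ θ φ, iteratedDeriv_two_partnerBand_ph_eq hA hd hr hlo hhi hρ h0 ϑ θ φ]
    refine (abs_jet_two_sub_le hf hK₁ hK₂ hK₃ _ _ _ _ _ _).trans ?_
    rw [show levelPoint μ K e (φ + θ) - pairDiffPath μ K ρ ϑ θ 0 - (levelPoint μ K 0 (φ + θ) - pairDiffPath μ K ρ ϑ θ 0) =
        levelPoint μ K e (φ + θ) - levelPoint μ K 0 (φ + θ) by abel,
      show iteratedDeriv 1 (levelPoint μ K e) (φ + θ) - (iteratedDeriv 1 (levelPoint μ K 0) θ - iteratedDeriv 1 (levelPoint μ K ρ) (ϑ + θ)) -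
          (iteratedDeriv 1 (levelPoint μ K 0) (φ + θ) - (iteratedDeriv 1 (levelPoint μ K 0) θ - iteratedDeriv 1 (levelPoint μ K ρ) (ϑ + θ))) =
        iteratedDeriv 1 (levelPoint μ K e) (φ + θ) - iteratedDeriv 1 (levelPoint μ K 0) (φ + θ) by abel,
      show iteratedDeriv 2 (levelPoint μ K e) (φ + θ) - (iteratedDeriv 2 (levelPoint μ K 0) θ - iteratedDeriv 2 (levelPoint μ K ρ) (ϑ + θ)) -
          (iteratedDeriv 2 (levelPoint μ K 0) (φ + θ) - (iteratedDeriv 2 (levelPoint μ K 0) θ - iteratedDeriv 2 (levelPoint μ K ρ) (ϑ + θ))) =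
        iteratedDeriv 2 (levelPoint μ K e) (φ + θ) - iteratedDeriv 2 (levelPoint μ K 0) (φ + θ) by abel]
    have hΔ0 : ‖levelPoint μ K e (φ + θ) - levelPoint μ K 0 (φ + θ)‖ ≤ |e| / dd := by
      have h := norm_levelPoint_sub_levelPoint_le B₀ hA hADt hlo hhi (ρ := e) (ρ' := 0) ⟨(abs_lt.1 he).1, (abs_lt.1 he).2⟩ ⟨by linarith, hr⟩ (φ + θ)
      rwa [sub_zero] at h
    have hΔ1 : ‖iteratedDeriv 1 (levelPoint μ K e) (φ + θ) - iteratedDeriv 1 (levelPoint μ K 0) (φ + θ)‖ ≤ radialRowOneConst A dd * |e| :=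
      norm_iteratedDeriv_one_levelPoint_sub_le hA hd hr hlo hhi he (φ + θ)
    have hΔ2 : ‖iteratedDeriv 2 (levelPoint μ K e) (φ + θ) - iteratedDeriv 2 (levelPoint μ K 0) (φ + θ)‖ ≤
        (uRowTwoConst A A₃ dd + 1 / dd + 2 * (radialRowOneConst A dd - 1 / dd)) * |e| :=
      norm_iteratedDeriv_two_levelPoint_sub_le hA hA20 hd hr hlo hhi hA₃ hA₄ he (φ + θ)
    have hu₁ := hU₁ hρ he ϑ
    have hv₁ := hU₁ hρ h0 ϑ
    have hu₂ := hU₂ hρ he ϑ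
    have hP1 : 0 ≤ K₃ * (|e| / dd) := mul_nonneg hK₃0 (div_nonneg (abs_nonneg e) hdpos.le)
    have hP2 : 0 ≤ K₂ * (radialRowOneConst A dd * |e|) := mul_nonneg hK₂0 ((norm_nonneg _).trans hΔ1)
    have hP3 : 0 ≤ K₂ * (|e| / dd) := mul_nonneg hK₂0 (div_nonneg (abs_nonneg e) hdpos.le)
    gcongr
  -- STEP 2: the configuration `(ρ, ϑ) → (0, π)` at loop level `0`
  have step2 : |iteratedDeriv 2 (fun t : ℝ => frameLevel μ K (levelPoint μ K 0 (φ + θ + t) - pairDiffPath μ K ρ ϑ θ t)) 0 -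
      iteratedDeriv 2 (fun t : ℝ => frameLevel μ K (levelPoint μ K 0 (φ + θ + t) - pairDiffPath μ K 0 π θ t)) 0| ≤
      (K₃ * (|ρ| / ((bandBounds (show (-4 : ℝ) < -1.1 by norm_num) (show (-1.1 : ℝ) ≤ -0.1 by norm_num) (show (-0.1 : ℝ) < 0 by norm_num)).Dtmin - 2 * A) + msD A₃ A₄ 1 * |ϑ - π|) * (3 * msD A₃ A₄ 1) ^ 2 + K₂ * (radialRowOneConst A ((bandBounds (show (-4 : ℝ) < -1.1 by norm_num) (show (-1.1 : ℝ) ≤ -0.1 by norm_num) (show (-0.1 : ℝ) < 0 by norm_num)).Dtmin - 2 * A) * |ρ| + msD A₃ A₄ 2 * |ϑ - π|) * (3 * msD A₃ A₄ 1 + 3 * msD A₃ A₄ 1) +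
          K₂ * (|ρ| / ((bandBounds (show (-4 : ℝ) < -1.1 by norm_num) (show (-1.1 : ℝ) ≤ -0.1 by norm_num) (show (-0.1 : ℝ) < 0 by norm_num)).Dtmin - 2 * A) + msD A₃ A₄ 1 * |ϑ - π|) * (3 * msD A₃ A₄ 2) + K₁ * ((uRowTwoConst A A₃ ((bandBounds (show (-4 : ℝ) < -1.1 by norm_num) (show (-1.1 : ℝ) ≤ -0.1 by norm_num) (show (-0.1 : ℝ) < 0 by norm_num)).Dtmin - 2 * A) + 1 / ((bandBounds (show (-4 : ℝ) < -1.1 by norm_num) (show (-1.1 : ℝ) ≤ -0.1 by norm_num) (show (-0.1 : ℝ) < 0 by norm_num)).Dtmin - 2 * A) + 2 * (radialRowOneConst A ((bandBounds (show (-4 : ℝ) < -1.1 by norm_num) (show (-1.1 : ℝ) ≤ -0.1 by norm_num) (show (-0.1 : ℝ) < 0 by norm_num)).Dtmin - 2 * A) - 1 / ((bandBounds (show (-4 : ℝ) < -1.1 by norm_num) (show (-1.1 : ℝ) ≤ -0.1 by norm_num) (show (-0.1 : ℝ) < 0 by norm_num)).Dtmin - 2 * A))) * |ρ| + msD A₃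 A₄ 3 * |ϑ - π|)) := by
    have hπ : |(0 : ℝ)| < r := h0
    rw [iteratedDeriv_two_partnerBand_ph_eq hA hd hr hlo hhi hρ h0 ϑ θ φ, iteratedDeriv_two_partnerBand_ph_eq hA hd hr hlo hhi hπ h0 π θ φ]
    refine (abs_jet_two_sub_le hf hK₁ hK₂ hK₃ _ _ _ _ _ _).trans ?_
    have hp : levelPoint μ K 0 (φ + θ) - pairDiffPath μ K ρ ϑ θ 0 - (levelPoint μ K 0 (φ + θ) - pairDiffPath μ K 0 π θ 0) = pairSumPath μ K ρ ϑ θ 0 := by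
      rw [← pairDiffPath_pi_sub_eq_pairSumPath]; abel
    have hq1 : iteratedDeriv 1 (levelPoint μ K 0) (φ + θ) - (iteratedDeriv 1 (levelPoint μ K 0) θ - iteratedDeriv 1 (levelPoint μ K ρ) (ϑ + θ)) -
        (iteratedDeriv 1 (levelPoint μ K 0) (φ + θ) - (iteratedDeriv 1 (levelPoint μ K 0) θ - iteratedDeriv 1 (levelPoint μ K 0) (π + θ))) = iteratedDeriv 1 (pairSumPath μ K ρ ϑ θ) 0 := by
      rw [iteratedDeriv_pairSumPath_zero_eq_neg_sub hA hd hr hlo hhi hρ ϑ θ 1]; abel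
    have hq2 : iteratedDeriv 2 (levelPoint μ K 0) (φ + θ) - (iteratedDeriv 2 (levelPoint μ K 0) θ - iteratedDeriv 2 (levelPoint μ K ρ) (ϑ + θ)) -
        (iteratedDeriv 2 (levelPoint μ K 0) (φ + θ) - (iteratedDeriv 2 (levelPoint μ K 0) θ - iteratedDeriv 2 (levelPoint μ K 0) (π + θ))) = iteratedDeriv 2 (pairSumPath μ K ρ ϑ θ) 0 := by
      rw [iteratedDeriv_pairSumPath_zero_eq_neg_sub hA hd hr hlo hhi hρ ϑ θ 2]; abel
    rw [hp, hq1, hq2]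
    have hΔ0 : ‖pairSumPath μ K ρ ϑ θ 0‖ ≤ |ρ| / dd + msD A₃ A₄ 1 * |ϑ - π| := norm_pairSumPath_zero_le hA hA20 hd hr hlo hhi hA₃ hA₄ hρ ϑ θ
    have hΔ1 : ‖iteratedDeriv 1 (pairSumPath μ K ρ ϑ θ) 0‖ ≤ radialRowOneConst A dd * |ρ| + msD A₃ A₄ 2 * |ϑ - π| :=
      norm_deriv_pairSumPath_le_rigid hA hA20 hd hr hlo hhi hA₃ hA₄ hρ ϑ θ
    have hΔ2 : ‖iteratedDeriv 2 (pairSumPath μ K ρ ϑ θ) 0‖ ≤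
        (uRowTwoConst A A₃ dd + 1 / dd + 2 * (radialRowOneConst A dd - 1 / dd)) * |ρ| + msD A₃ A₄ 3 * |ϑ - π| :=
      norm_iteratedDeriv_pairSumPath_le_rigid hA hA20 hd hr hlo hhi hA₃ hA₄ hρ (i := 2) (by norm_num)
        (fun s => norm_iteratedDeriv_two_levelPoint_sub_le hA hA20 hd hr hlo hhi hA₃ hA₄ hρ s) ϑ θ
    have hu₁ := hU₁ hρ h0 ϑ
    have hv₁ := hU₁ hπ h0 π
    have hu₂ := hU₂ hρ h0 ϑ
    have hs0 : 0 ≤ |ρ| / dd + msD A₃ A₄ 1 * |ϑ - π| := add_nonneg (div_nonneg (abs_nonneg ρ) hdpos.le) (mul_nonneg hD₁0 (abs_nonneg _))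
    have hP1 : 0 ≤ K₃ * (|ρ| / dd + msD A₃ A₄ 1 * |ϑ - π|) := mul_nonneg hK₃0 hs0
    have hP2 : 0 ≤ K₂ * (radialRowOneConst A dd * |ρ| + msD A₃ A₄ 2 * |ϑ - π|) := mul_nonneg hK₂0 ((norm_nonneg _).trans hΔ1)
    have hP3 : 0 ≤ K₂ * (|ρ| / dd + msD A₃ A₄ 1 * |ϑ - π|) := mul_nonneg hK₂0 hs0
    gcongr
  -- STEP 3: the order-2 core at the `2k_F` configuration with the loop on the Fermi curve (`e_K` even)
  have step3 : |iteratedDeriv 2 (fun t : ℝ => frameLevel μ K (levelPoint μ K 0 (φ + θ + t) - pairDiffPath μ K 0 π θ t)) 0| ≤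
      (K₄ * msD A₃ A₄ 1 ^ 2 * (msD A₃ A₄ 1 + |φ| * msD A₃ A₄ 2) ^ 2 + 4 * K₃ * msD A₃ A₄ 1 * msD A₃ A₄ 2 * (msD A₃ A₄ 1 + |φ| * msD A₃ A₄ 2) + 2 * K₂ * msD A₃ A₄ 2 ^ 2 + K₃ * msD A₃ A₄ 1 ^ 2 * (msD A₃ A₄ 2 + |φ| * msD A₃ A₄ 3) + 2 * K₂ * msD A₃ A₄ 1 * msD A₃ A₄ 3 +
          K₃ * msD A₃ A₄ 2 * (msD A₃ A₄ 1 + |φ| * msD A₃ A₄ 2 + msD A₃ A₄ 3 * φ ^ 2) ^ 2 + K₂ * msD A₃ A₄ 3 * (2 * (msD A₃ A₄ 1 + |φ| * msD A₃ A₄ 2) + msD A₃ A₄ 3 * φ ^ 2) + K₂ * msD A₃ A₄ 2 * (msD A₃ A₄ 2 + |φ| * msD A₃ A₄ 3 + msD A₃ A₄ 4 * φ ^ 2) + K₁ * msD A₃ A₄ 4) *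
        φ ^ 2 := by
    have hfun : (fun t : ℝ => frameLevel μ K (levelPoint μ K 0 (φ + θ + t) - pairDiffPath μ K 0 π θ t)) = fun t : ℝ =>
        frameLevel μ K (levelPoint μ K 0 (θ + t) + levelPoint μ K 0 (θ + t) - levelPoint μ K 0 (φ + θ + t)) := by
      funext t
      rw [pairDiffPath_tangency, show levelPoint μ K 0 (φ + θ + t) - (levelPoint μ K 0 (θ + t) + levelPoint μ K 0 (θ + t)) =
        -(levelPoint μ K 0 (θ + t) + levelPoint μ K 0 (θ + t) - levelPoint μ K 0 (φ + θ + t)) by abel, frameLevel_neg]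
    rw [hfun]
    exact abs_iteratedDeriv_two_tangency_core_le hf hK₁ hK₂ hK₃ hK₄ (contDiff_levelPoint_angle B₀ hA hADt hlo hhi h0)
      (fun s => frameLevel_levelPoint_zero B₀ hA hr hlo hhi s) (fun s => hD h0 le_rfl (by norm_num) s) (fun s => hD h0 (by norm_num) (by norm_num) s)
      (fun s => hD h0 (by norm_num) (by norm_num) s) (fun s => hD h0 (by norm_num) (by norm_num) s) θ φ
  -- assemble
  have tri := abs_sub_abs_le_abs_sub (iteratedDeriv 2 (fun t : ℝ => frameLevel μ K (levelPoint μ K e (φ + θ + t) - pairDiffPath μ K ρ ϑ θ t)) 0)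
    (iteratedDeriv 2 (fun t : ℝ => frameLevel μ K (levelPoint μ K 0 (φ + θ + t) - pairDiffPath μ K ρ ϑ θ t)) 0)
  have tri' := abs_sub_abs_le_abs_sub (iteratedDeriv 2 (fun t : ℝ => frameLevel μ K (levelPoint μ K 0 (φ + θ + t) - pairDiffPath μ K ρ ϑ θ t)) 0)
    (iteratedDeriv 2 (fun t : ℝ => frameLevel μ K (levelPoint μ K 0 (φ + θ + t) - pairDiffPath μ K 0 π θ t)) 0)
  linarith

end Sizes

end Summit.HubbardSuperconductivity.HubbardSuperconductivity.Theorems.C4a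

end
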